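import Literature.MathematicalPhysics.QuantumFieldTheory.Balaban1983to89.B3Taylor310Remainder
import Literature.MathematicalPhysics.QuantumFieldTheory.Balaban1983to89.B3TorusRadialSums

/-!
# `Balaban1983to89.B3Bound316` — T. Bałaban, *(Higgs)₂,₃ quantum fields in a finite volume. III. Renormalization*, Commun. Math.
Phys. **88** (1983) 411–445 [Balaban1983Higgs3], p. 437 [PDF 27]: the last step of the analysis of the scalar self-energy graph (3.8) —
**"we can estimate (3.16) by a constant"** — PROVED in `d = 3` on the torus calculus, uniformly in the lattice spacing `ξ` and in
the volume, from the printed kernel bounds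

statement-level skeleton of published theorems with citation tags; proofs where landed; nothing here is a claim about the Yang–Mills mass gap

PDF held: `paper:balaban1983-higgs-2-3-quantum-fields-finite-volume` (journal page = PDF page + 410); p. 437 read on the ×2 render
`run/shared/lean/pub/pub-balaban/b2b-balaban-ref1/pages/1983-cmp88-higgs23-III/1983-cmp88-higgs23-III-p027-x2.png`.

CITATION HEADER (lean-in-tree rule).  Part of the lit-balaban TYPED SKELETON (HOME `run/shared/lean/pub/lit-balaban/`), PHASE 2, seat p20
generation 2.  Row **B3.Eq3.11-3.17** of `HOME/lit-balaban-r15/ROWS-B3.md` (fold owner r15): the (3.16) bracket is r15's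
`B3Sect3ScalarSelfEnergy.bracket316` (p246479; its ASSEMBLY from (3.15) is `eq316_bracket` there); this file proves the printed
CONCLUSION about it.  Tools: `B3TorusRadialSums` (same seat: radial lattice sums with an integrable singularity, uniform in `ξ` and
the volume) and `B3Taylor310Remainder` (the displacement `disp` of (3.10)/(3.11), for the instance `dx = (y′_μ − y_μ)`).

THE PRINTED TEXT (verbatim, p. 437).  *"Let us estimate the coefficient in the vertex, i.e. the expression in the square brackets in
(3.15). Rescaling it from the η-lattice to the L^{−j″}-lattice … ξ = L^{−j″}. … so the expression is equal to
−q²Σ_{y′}ξ^dC^ξ(y−y′)g(y)G^ξ_{j″}(y,y′)g(y′)(y′_μ − y_μ) + q²Σ_{y′}ξ^d(Σ_{ν=1}^d(∂^ξ_νG^ξ_{j″}(0)(1 − m²_{j″} − a_{j″}P_{j″})C^ξ∂^{ξ*}_ν)(y,y′))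
·g(y)G^ξ_{j″}(y,y′)g′(y′)(y′_μ − y_μ). (3.16)  Using the inequalities |C^ξ(y − y′)| ≤ O(1)e^{−½|y−y′|}/|y − y′|,
|G^ξ_{j″}(0; y, y′)| ≤ O(1)e^{−δ₀|y−y′|}/|y − y′|, and the corresponding inequalities for derivatives, we can estimate (3.16) by a
constant. Thus we have finished the analysis of (3.8)"*.

WHAT IS TYPED / PROVED, and how (d = 3, the dimension in which p. 437 writes the singularities `1/|y − y′|`).  **`abs_bracket316_le`**:
if, with `|y − y′| = ξ·|y − y′|_∞` the physical sup distance on the `ξ`-lattice (`LatticeFieldCalculus.supDist`) and one decay rate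
`δ` (= min(½, δ₀) of print), the free propagator obeys `|C^ξ(y,y′)| ≤ A e^{−δ|y−y′|}/|y−y′|` (`y′ ≠ y`), the second propagator
`|G^ξ_{j″}(y,y′)| ≤ B e^{−δ|y−y′|}/|y−y′|` (`y′ ≠ y`), the differentiated kernel `|(∂^ξ_νM∂^{ξ*}_ν)(y,y′)| ≤ B′e^{−δ|y−y′|}/|y−y′|²`
(`y′ ≠ y`, every `ν`; `M` = the kernel of `G^ξ_{j″}(0)(1 − m²_{j″} − a_{j″}P_{j″})C^ξ` — this is the READING of *"the corresponding
inequalities for derivatives"*, a hypothesis here), the localization functions `|g|, |g′| ≤ 1`, and the displacement `|dx_μ(y,y′)| ≤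
ξ|y − y′|₁` (true for the printed `(y′_μ − y_μ)` along `Γ_{y,y′}`: `abs_disp_le`), then for EVERY `y`
`|[(3.16)](y)| ≤ 3B·(A·R₁ + 3B′·R₂)`, `R₁ = radialConst 3 δ ξ 1`, `R₂ = radialConst 3 δ ξ 0` (`radialConst d δ ξ p =
2d·3^{d−1}·p!(2/δ)^p(ξ + 2/δ)`), a constant depending on `A, B, B′, δ` and monotone in `ξ`, hence bounded by its value at `ξ = 1`
for all spacings `ξ ≤ 1` (`abs_bracket316_le_uniform`) — UNIFORMLY IN THE VOLUME.  Mechanism (kernel-checked): the displacement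
`(y′_μ − y_μ)` cancels one power of the singularity, leaving the Riemann sums `Σ_{y′≠y}ξ³e^{−δ|y−y′|}/|y−y′|` and `Σ ξ³e^{−δ|y−y′|}/|y−y′|²`
(`B3TorusRadialSums.riemann_radial_sum_le`, `κ = 1, 2`); the diagonal term `y′ = y` vanishes with the displacement.  `abs_bracket316_le_disp`:
the instance `dx = B3Taylor310Remainder.disp ξ⁻¹` (the (3.11)/(3.15) displacement).  NOT claimed: the kernel bounds themselves (rows
B3.Eq2.10–2.12 / [Balaban1982Higgs1] Props. 2.1, 2.3), the values of `O(1)`, `d = 2`.  Unit `lit-balaban-p20`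
(literature-prover-lit-balaban-p20-g2-0), 2026-08-21.
-/

open scoped BigOperators

namespace Literature.MathematicalPhysics.QuantumFieldTheory.Balaban1983to89.B3Bound316

open LatticeFieldCalculus B3Sect3ScalarSelfEnergy B3Taylor310Remainder B3TorusRadialSums

noncomputable section

variable {P : Params} {j : ℕ}

/-! ## 1. The constant and the displacement hypothesis -/

/-- The constant of the radial Riemann sums (`B3TorusRadialSums.riemann_radial_sum_le`): `2d·3^{d−1}·p!·(2/δ)^p·(ξ + 2/δ)`.
[cite: Balaban1983Higgs3, (3.16) p.437] -/
def radialConst (d : ℕ) (δ ξ : ℝ) (p : ℕ) : ℝ := 2 * d * (3 ^ (d - 1) * (p.factorial * (2 / δ) ^ p) * (ξ + 2 / δ))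

/-- The radial constant is nonnegative (`δ > 0`, `ξ ≥ 0`). [cite: Balaban1983Higgs3, (3.16) p.437] -/
theorem radialConst_nonneg (d : ℕ) {δ ξ : ℝ} (hδ : 0 < δ) (hξ : 0 ≤ ξ) (p : ℕ) : 0 ≤ radialConst d δ ξ p := by
  unfold radialConst; positivity

/-- The radial constant is monotone in the lattice spacing `ξ`. [cite: Balaban1983Higgs3, (3.16) p.437] -/
theorem radialConst_mono (d : ℕ) {δ ξ ξ' : ℝ} (hδ : 0 < δ) (hξ : ξ ≤ ξ') (p : ℕ) : radialConst d δ ξ p ≤ radialConst d δ ξ' p := by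
  unfold radialConst
  gcongr

/-- The printed displacement `(y′_μ − y_μ)` along `Γ_{y,y′}` (`B3Taylor310Remainder.disp`, with `c = ξ⁻¹`) is at most the `ℓ¹` distance:
`|y′_μ − y_μ| ≤ ξ|y − y′|₁`. [cite: Balaban1983Higgs3, (3.16) p.437] -/
theorem abs_disp_le {c : ℝ} (hc : 0 < c) (y y' : Site P j) (μ : Fin P.d) :
    |disp c y y' μ| ≤ c⁻¹ * (Site.tdist y y' : ℝ) := by
  rw [disp, abs_mul, abs_of_nonneg (inv_nonneg.mpr hc.le)]
  refine mul_le_mul_of_nonneg_left ?_ (inv_nonneg.mpr hc.le)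
  rw [← Int.cast_abs, Int.abs_eq_natAbs, Int.cast_natCast, ← Int.toNat_add_toNat_neg_eq_natAbs, ← sum_steps_eq_tdist y y']
  exact_mod_cast Finset.single_le_sum (f := fun ν : Fin P.d => (steps y y' ν).toNat + (-steps y y' ν).toNat)
    (fun _ _ => Nat.zero_le _) (Finset.mem_univ μ)

/-- kernel: `|y − y|₁ = 0`. [folklore] -/
private theorem tdist_self (y : Site P j) : Site.tdist y y = 0 := by
  simp [Site.tdist]

/-! ## 2. "(3.16) is estimated by a constant" (d = 3) -/

/-- kernel: the per-site estimate of the summand of (3.16) off the diagonal — the displacement cancels one power of the singularity.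
[cite: Balaban1983Higgs3, (3.16) p.437] -/
private theorem term316_le (hd : P.d = 3) {ξ : ℝ} (hξ : 0 < ξ) {δ A B B' : ℝ} (hδ : 0 < δ) (hA : 0 ≤ A) (hB : 0 ≤ B) (hB' : 0 ≤ B')
    (C M G : Kernel P j) (g g' : SiteField P j ℝ) (dx : Fin P.d → Site P j → Site P j → ℝ) (μ : Fin P.d) (y y' : Site P j)
    (hne : y' ≠ y)
    (hC : |C y y'| ≤ A * (ξ * supDist y y')⁻¹ * Real.exp (-(δ * (ξ * supDist y y'))))
    (hM : ∀ ν : Fin P.d, |dKernel ξ⁻¹ ν M y y'| ≤ B' * ((ξ * supDist y y') ^ 2)⁻¹ * Real.exp (-(δ * (ξ * supDist y y'))))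
    (hG : |G y y'| ≤ B * (ξ * supDist y y')⁻¹ * Real.exp (-(δ * (ξ * supDist y y'))))
    (hg : |g y| ≤ 1) (hg' : |g' y'| ≤ 1) (hdx : |dx μ y y'| ≤ ξ * Site.tdist y y') :
    |ξ ^ P.d * ((-C y y' + ∑ ν : Fin P.d, dKernel ξ⁻¹ ν M y y') * g y * G y y' * g' y' * dx μ y y')|
      ≤ P.d * B * (A * (ξ ^ P.d * (((ξ * supDist y y') ^ 1)⁻¹ * Real.exp (-(δ * (ξ * supDist y y')))))
          + P.d * B' * (ξ ^ P.d * (((ξ * supDist y y') ^ 2)⁻¹ * Real.exp (-(δ * (ξ * supDist y y')))))) := by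
  set sN : ℕ := supDist y y' with hsN
  have hs1 : 1 ≤ sN := by
    by_contra h0
    exact hne (((supDist_eq_zero_iff y y').mp (by omega)).symm)
  set r : ℝ := ξ * (sN : ℝ) with hr
  have hr0 : 0 < r := mul_pos hξ (by exact_mod_cast hs1)
  set e : ℝ := Real.exp (-(δ * r)) with he
  have he0 : 0 < e := Real.exp_pos _
  have he1 : e ≤ 1 := by
    rw [he, ← Real.exp_zero]; exact Real.exp_le_exp.mpr (by nlinarith [hr0.le, hδ.le])
  -- the four factor bounds
  have hS : |∑ ν : Fin P.d, dKernel ξ⁻¹ ν M y y'| ≤ P.d * (B' * (r ^ 2)⁻¹ * e) := by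
    calc |∑ ν : Fin P.d, dKernel ξ⁻¹ ν M y y'| ≤ ∑ ν : Fin P.d, |dKernel ξ⁻¹ ν M y y'| := Finset.abs_sum_le_sum_abs _ _
      _ ≤ ∑ _ν : Fin P.d, B' * (r ^ 2)⁻¹ * e := Finset.sum_le_sum fun ν _ => hM ν
      _ = P.d * (B' * (r ^ 2)⁻¹ * e) := by rw [Finset.sum_const, Finset.card_univ, Fintype.card_fin, nsmul_eq_mul]
  have hCS : |-C y y' + ∑ ν : Fin P.d, dKernel ξ⁻¹ ν M y y'| ≤ A * r⁻¹ * e + P.d * (B' * (r ^ 2)⁻¹ * e) := by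
    calc |-C y y' + ∑ ν : Fin P.d, dKernel ξ⁻¹ ν M y y'| ≤ |-C y y'| + |∑ ν : Fin P.d, dKernel ξ⁻¹ ν M y y'| := abs_add_le _ _
      _ ≤ A * r⁻¹ * e + P.d * (B' * (r ^ 2)⁻¹ * e) := by rw [abs_neg]; exact add_le_add hC hS
  have hdx' : |dx μ y y'| ≤ P.d * r := by
    refine hdx.trans ?_
    have h1 : (Site.tdist y y' : ℝ) ≤ P.d * sN := by exact_mod_cast tdist_le_mul_supDist y y'
    calc ξ * (Site.tdist y y' : ℝ) ≤ ξ * (P.d * sN) := mul_le_mul_of_nonneg_left h1 hξ.le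
      _ = P.d * r := by rw [hr]; ring
  have hA' : 0 ≤ A * r⁻¹ * e + P.d * (B' * (r ^ 2)⁻¹ * e) := by positivity
  have hG' : 0 ≤ B * r⁻¹ * e := by positivity
  -- the product
  have hprod : |ξ ^ P.d * ((-C y y' + ∑ ν : Fin P.d, dKernel ξ⁻¹ ν M y y') * g y * G y y' * g' y' * dx μ y y')|
      ≤ ξ ^ P.d * ((A * r⁻¹ * e + P.d * (B' * (r ^ 2)⁻¹ * e)) * 1 * (B * r⁻¹ * e) * 1 * (P.d * r)) := by
    rw [abs_mul, abs_of_nonneg (by positivity : (0:ℝ) ≤ ξ ^ P.d), abs_mul, abs_mul, abs_mul, abs_mul]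
    refine mul_le_mul_of_nonneg_left ?_ (by positivity)
    have h1 := hg; have h2 := hG; have h3 := hg'; have h4 := hdx'; have h5 := hCS
    gcongr
  -- algebra: `r⁻¹·r = 1`, `e² ≤ e`
  have hrr : r⁻¹ * r = 1 := inv_mul_cancel₀ hr0.ne'
  have hrew : ξ ^ P.d * ((A * r⁻¹ * e + P.d * (B' * (r ^ 2)⁻¹ * e)) * 1 * (B * r⁻¹ * e) * 1 * (P.d * r))
      = (P.d * B * (A * (ξ ^ P.d * (r⁻¹ * e)) + P.d * B' * (ξ ^ P.d * ((r ^ 2)⁻¹ * e)))) * e := by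
    calc ξ ^ P.d * ((A * r⁻¹ * e + P.d * (B' * (r ^ 2)⁻¹ * e)) * 1 * (B * r⁻¹ * e) * 1 * (P.d * r))
        = (P.d * B * (A * (ξ ^ P.d * (r⁻¹ * e)) + P.d * B' * (ξ ^ P.d * ((r ^ 2)⁻¹ * e)))) * e * (r⁻¹ * r) := by ring
      _ = _ := by rw [hrr, mul_one]
  have hmain : 0 ≤ P.d * B * (A * (ξ ^ P.d * (r⁻¹ * e)) + P.d * B' * (ξ ^ P.d * ((r ^ 2)⁻¹ * e))) := by positivity
  calc |ξ ^ P.d * ((-C y y' + ∑ ν : Fin P.d, dKernel ξ⁻¹ ν M y y') * g y * G y y' * g' y' * dx μ y y')|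
      ≤ (P.d * B * (A * (ξ ^ P.d * (r⁻¹ * e)) + P.d * B' * (ξ ^ P.d * ((r ^ 2)⁻¹ * e)))) * e := by rw [← hrew]; exact hprod
    _ ≤ (P.d * B * (A * (ξ ^ P.d * (r⁻¹ * e)) + P.d * B' * (ξ ^ P.d * ((r ^ 2)⁻¹ * e)))) * 1 :=
        mul_le_mul_of_nonneg_left he1 hmain
    _ = _ := by rw [mul_one, pow_one]

/-- **"(3.16) is estimated by a constant"** (p. 437 [PDF 27]), `d = 3`, PROVED: under the printed kernel bounds `|C^ξ(y,y′)| ≤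
Ae^{−δ|y−y′|}/|y−y′|`, `|G^ξ_{j″}(y,y′)| ≤ Be^{−δ|y−y′|}/|y−y′|` (`y′ ≠ y`; `|y − y′| = ξ|y − y′|_∞`), the derivative-kernel bound
`|(∂^ξ_νM∂^{ξ*}_ν)(y,y′)| ≤ B′e^{−δ|y−y′|}/|y−y′|²` (`y′ ≠ y`; the reading of *"the corresponding inequalities for derivatives"*), `|g|, |g′| ≤ 1`
and `|dx_μ(y,y′)| ≤ ξ|y − y′|₁`, the bracket of (3.16) satisfies, for every `y`,
`|Σ_{y′}ξ³[−C^ξ + Σ_ν(∂_νM∂_ν^*)](y,y′)g(y)G^ξ_{j″}(y,y′)g′(y′)dx_μ(y,y′)| ≤ 3B(A·radialConst 3 δ ξ 1 + 3B′·radialConst 3 δ ξ 0)` — a constant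
independent of `y` and of the volume. [cite: Balaban1983Higgs3, (3.16) p.437] -/
theorem abs_bracket316_le (hd : P.d = 3) {ξ : ℝ} (hξ : 0 < ξ) {δ A B B' : ℝ} (hδ : 0 < δ) (hA : 0 ≤ A) (hB : 0 ≤ B)
    (hB' : 0 ≤ B') (C M G : Kernel P j) (g g' : SiteField P j ℝ) (dx : Fin P.d → Site P j → Site P j → ℝ) (μ : Fin P.d)
    (hC : ∀ y y' : Site P j, y' ≠ y → |C y y'| ≤ A * (ξ * supDist y y')⁻¹ * Real.exp (-(δ * (ξ * supDist y y'))))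
    (hM : ∀ (ν : Fin P.d) (y y' : Site P j), y' ≠ y →
      |dKernel ξ⁻¹ ν M y y'| ≤ B' * ((ξ * supDist y y') ^ 2)⁻¹ * Real.exp (-(δ * (ξ * supDist y y'))))
    (hG : ∀ y y' : Site P j, y' ≠ y → |G y y'| ≤ B * (ξ * supDist y y')⁻¹ * Real.exp (-(δ * (ξ * supDist y y'))))
    (hg : ∀ y, |g y| ≤ 1) (hg' : ∀ y, |g' y| ≤ 1)
    (hdx : ∀ y y' : Site P j, |dx μ y y'| ≤ ξ * Site.tdist y y') (y : Site P j) :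
    |bracket316 ξ C M G g g' dx μ y| ≤
      P.d * B * (A * radialConst P.d δ ξ 1 + P.d * B' * radialConst P.d δ ξ 0) := by
  classical
  -- the diagonal term vanishes with the displacement
  have hdiag : dx μ y y = 0 := by
    have h := hdx y y
    rw [tdist_self, Nat.cast_zero, mul_zero] at h
    exact abs_nonpos_iff.mp h
  set F : Site P j → ℝ := fun y' =>
    ξ ^ P.d * ((-C y y' + ∑ ν : Fin P.d, dKernel ξ⁻¹ ν M y y') * g y * G y y' * g' y' * dx μ y y') with hF
  have hF0 : F y = 0 := by simp only [hF, hdiag, mul_zero]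
  -- off-diagonal per-site bound
  set X1 : Site P j → ℝ := fun y' => ξ ^ P.d * (((ξ * supDist y y') ^ 1)⁻¹ * Real.exp (-(δ * (ξ * supDist y y')))) with hX1
  set X2 : Site P j → ℝ := fun y' => ξ ^ P.d * (((ξ * supDist y y') ^ 2)⁻¹ * Real.exp (-(δ * (ξ * supDist y y')))) with hX2
  have hterm : ∀ y' ∈ Finset.univ.filter (fun y' : Site P j => y' ≠ y),
      |F y'| ≤ P.d * B * (A * X1 y' + P.d * B' * X2 y') := by
    intro y' hy'
    have hne : y' ≠ y := (Finset.mem_filter.mp hy').2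
    exact term316_le hd hξ hδ hA hB hB' C M G g g' dx μ y y' hne (hC y y' hne) (fun ν => hM ν y y' hne) (hG y y' hne)
      (hg y) (hg' y') (hdx y y')
  -- the two radial sums
  have hR1 : ∑ y' ∈ Finset.univ.filter (fun y' : Site P j => y' ≠ y), X1 y' ≤ radialConst P.d δ ξ 1 := by
    have h := riemann_radial_sum_le y hδ hξ (κ := 1) (p := 1) (by omega)
    simpa [radialConst, hX1] using h
  have hR2 : ∑ y' ∈ Finset.univ.filter (fun y' : Site P j => y' ≠ y), X2 y' ≤ radialConst P.d δ ξ 0 := by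
    have h := riemann_radial_sum_le y hδ hξ (κ := 2) (p := 0) (by omega)
    simpa [radialConst, hX2] using h
  -- assemble
  unfold bracket316
  calc |∑ y' : Site P j, ξ ^ P.d * ((-C y y' + ∑ ν : Fin P.d, dKernel ξ⁻¹ ν M y y') * g y * G y y' * g' y' * dx μ y y')|
      = |∑ y' : Site P j, F y'| := rfl
    _ ≤ ∑ y' : Site P j, |F y'| := Finset.abs_sum_le_sum_abs _ _
    _ = ∑ y' ∈ Finset.univ.filter (fun y' : Site P j => y' ≠ y), |F y'| := by
        symm
        refine Finset.sum_subset (Finset.filter_subset _ _) fun y' _ hy' => ?_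
        have : y' = y := by
          by_contra h; exact hy' (Finset.mem_filter.mpr ⟨Finset.mem_univ _, h⟩)
        rw [this, hF0, abs_zero]
    _ ≤ ∑ y' ∈ Finset.univ.filter (fun y' : Site P j => y' ≠ y), P.d * B * (A * X1 y' + P.d * B' * X2 y') :=
        Finset.sum_le_sum hterm
    _ = P.d * B * (A * ∑ y' ∈ Finset.univ.filter (fun y' : Site P j => y' ≠ y), X1 y'
          + P.d * B' * ∑ y' ∈ Finset.univ.filter (fun y' : Site P j => y' ≠ y), X2 y') := by
        rw [Finset.mul_sum, Finset.mul_sum, ← Finset.sum_add_distrib, Finset.mul_sum]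
    _ ≤ P.d * B * (A * radialConst P.d δ ξ 1 + P.d * B' * radialConst P.d δ ξ 0) := by
        gcongr

/-- The same bound with `ξ` replaced by `1` in the constant: for all spacings `0 < ξ ≤ 1` the bracket of (3.16) is bounded by ONE
constant `3B(A·radialConst 3 δ 1 1 + 3B′·radialConst 3 δ 1 0)` — uniformly in `ξ` and in the volume, as used on p. 437
("estimate (3.16) by a constant", in the limit `ξ = L^{−j″} → 0`). [cite: Balaban1983Higgs3, (3.16) p.437] -/
theorem abs_bracket316_le_uniform (hd : P.d = 3) {ξ : ℝ} (hξ : 0 < ξ) (hξ1 : ξ ≤ 1) {δ A B B' : ℝ} (hδ : 0 < δ) (hA : 0 ≤ A)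
    (hB : 0 ≤ B) (hB' : 0 ≤ B') (C M G : Kernel P j) (g g' : SiteField P j ℝ) (dx : Fin P.d → Site P j → Site P j → ℝ)
    (μ : Fin P.d)
    (hC : ∀ y y' : Site P j, y' ≠ y → |C y y'| ≤ A * (ξ * supDist y y')⁻¹ * Real.exp (-(δ * (ξ * supDist y y'))))
    (hM : ∀ (ν : Fin P.d) (y y' : Site P j), y' ≠ y →
      |dKernel ξ⁻¹ ν M y y'| ≤ B' * ((ξ * supDist y y') ^ 2)⁻¹ * Real.exp (-(δ * (ξ * supDist y y'))))
    (hG : ∀ y y' : Site P j, y' ≠ y → |G y y'| ≤ B * (ξ * supDist y y')⁻¹ * Real.exp (-(δ * (ξ * supDist y y'))))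
    (hg : ∀ y, |g y| ≤ 1) (hg' : ∀ y, |g' y| ≤ 1)
    (hdx : ∀ y y' : Site P j, |dx μ y y'| ≤ ξ * Site.tdist y y') (y : Site P j) :
    |bracket316 ξ C M G g g' dx μ y| ≤
      P.d * B * (A * radialConst P.d δ 1 1 + P.d * B' * radialConst P.d δ 1 0) := by
  refine (abs_bracket316_le hd hξ hδ hA hB hB' C M G g g' dx μ hC hM hG hg hg' hdx y).trans ?_
  have h1 := radialConst_mono P.d hδ hξ1 1
  have h2 := radialConst_mono P.d hδ hξ1 0
  have hd0 : (0 : ℝ) ≤ P.d := Nat.cast_nonneg _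
  gcongr

/-- The instance of the displacement hypothesis by the printed `(y′_μ − y_μ)` of (3.15)/(3.16) on the `ξ`-lattice
(`dx = B3Taylor310Remainder.disp ξ⁻¹`, the displacement of `eq311_taylor`): the (3.16) bracket with this `dx` is bounded by the same
constant. [cite: Balaban1983Higgs3, (3.16) p.437] -/
theorem abs_bracket316_le_disp (hd : P.d = 3) {ξ : ℝ} (hξ : 0 < ξ) {δ A B B' : ℝ} (hδ : 0 < δ) (hA : 0 ≤ A) (hB : 0 ≤ B)
    (hB' : 0 ≤ B') (C M G : Kernel P j) (g g' : SiteField P j ℝ) (μ : Fin P.d)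
    (hC : ∀ y y' : Site P j, y' ≠ y → |C y y'| ≤ A * (ξ * supDist y y')⁻¹ * Real.exp (-(δ * (ξ * supDist y y'))))
    (hM : ∀ (ν : Fin P.d) (y y' : Site P j), y' ≠ y →
      |dKernel ξ⁻¹ ν M y y'| ≤ B' * ((ξ * supDist y y') ^ 2)⁻¹ * Real.exp (-(δ * (ξ * supDist y y'))))
    (hG : ∀ y y' : Site P j, y' ≠ y → |G y y'| ≤ B * (ξ * supDist y y')⁻¹ * Real.exp (-(δ * (ξ * supDist y y'))))
    (hg : ∀ y, |g y| ≤ 1) (hg' : ∀ y, |g' y| ≤ 1) (y : Site P j) :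
    |bracket316 ξ C M G g g' (fun μ y y' => disp ξ⁻¹ y y' μ) μ y| ≤
      P.d * B * (A * radialConst P.d δ ξ 1 + P.d * B' * radialConst P.d δ ξ 0) :=
  abs_bracket316_le hd hξ hδ hA hB hB' C M G g g' _ μ hC hM hG hg hg' (fun y y' => by
    have h := abs_disp_le (inv_pos.mpr hξ) y y' μ
    rwa [inv_inv] at h) y

end

end Literature.MathematicalPhysics.QuantumFieldTheory.Balaban1983to89.B3Bound316
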